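import Summits.ABC.ABC.Theses.CubicResolventAllowance
import Literature.Barriers.ABC.SzpiroEpsilonCannotBeDroppedProofs
import HarnessLib

/-!
# STUB-IDEAS `stub_realCubic` · ideator k2 (HOME FAMILY 2 — RESHAPE) · generation 15 — companion sketch

Crux `stmt-ABC-22740` (`CubicResolventAllowance.IndexSzpiro`), stub `stub_realCubic` (the `0 < d_K` half).
Plan text: `Cruxes/IndexSzpiro/STUB-IDEAS-stub_realCubic-2.md` (gen 15).

The one new Family-2 cell of gen 15 is STRENGTHEN-TO-SIMPLIFY RUN TO GROUND on the real half:
can `ε` be dropped / the exponent `6` lowered / the `|d_K|`-allowance made to absorb `ε` on the REAL `r = 0`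
class?  Answer (this file types it): NO on all three axes, and the witness lives inside ONE real cubic field
(`K₁₄₈ = ℚ(37a1[2])`, `d_K = 148`): Bennett–Yazdani 2012 §7 applied to `F = 37a1` (`X_F(6) ≅ y² = x³ + 37`,
Chen arXiv:1403.7557 Thm 3.9) plus 37-adic DENSITY of `X_F(6)(ℚ)` (certificate: the rational point
`2·(−1,6) + 5·(3,8)` has exact formal level 1 at 37, `T1b`).  The complex twin (`not_stubEpsZero`, k2-complex
gen 7) used the tree's nodal `X₁(3)`-family; §T2 explains why that family cannot serve the real `r = 0` class:
its real (`c = 6`) component `Y² = X³ − 216` is swallowed by a 3-isogeny and every curve on it has a RATIONAL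
2-torsion point (`r = 1`; it serves `QuadraticIndexSzpiro`, stmt-ABC-22741, with `K = ℚ(√2)` fixed).

Contents — `lean check`: rc 0, 0 sorry, 0 warnings; every theorem below is VERIFIED; the two `def … : Prop`
without proof are `BYFixedFieldTower` (the cell's residual fact, L-sized, not in print as stated) and
`TreeOrbitIsR1` (conjecture-grade, ⟸ `D(ℚ) = ⟨(10,28),(6,0)⟩`):
* §0  `StubRealCubic` (verbatim), `stub_of_indexSzpiro`.
* §T1 `RealAllowanceEpsZero A`, `RealExponent κ`, `BYFixedFieldTower`; glue `not_realAllowanceEpsZero_of_tower`,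
      `stubRealCubic_of_realAllowanceEpsZero_one`; the four elementary inputs of the 37-adic density step, all proved:
      `T1b_levelOnePoint` (explicit level-1 point), `T1c_reduction_generator`, `T1d_no_padic_twoTorsion`,
      `T1e_no_point_on_cusp` (Kodaira II).
* §T2 `T2a_nodal_line`, `T2b_twoTorsionPolynomial_mk`, `T2c_root_along_isogeny` (rational 2-torsion along the whole
      nodal pencil), `T2d_not_irreducible_of_root`, `TreeOrbitIsR1` (typed target).
-/

set_option linter.dupNamespace false
set_option linter.style.longLine false

noncomputable section

namespace Summit.ABC.ABC.Cruxes.IndexSzpiro.StubIdeas2RealG15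

open Polynomial
open Summit.ABC.ABC.Theses.CubicResolventAllowance (IndexSzpiro)

/-! ## §0 The stub, verbatim -/

/-- `stub_realCubic` (verbatim signature of the registered stub). -/
def StubRealCubic : Prop :=
  ∀ ε : ℝ, 0 < ε → ∃ C : ℝ, ∀ (W : WeierstrassCurve ℚ) [W.IsElliptic] (K : Type) [Field K] [NumberField K],
    Irreducible W.twoTorsionPolynomial.toPoly → Module.finrank ℚ K = 3 →
    (∃ θ : K, aeval θ W.twoTorsionPolynomial.toPoly = 0) → 0 < NumberField.discr K →
    (W.minimalDiscriminantNorm ℤ : ℝ) ≤ C * |(NumberField.discr K : ℝ)| * (W.conductorNorm ℤ : ℝ) ^ (6 + ε)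

/-- (VERIFIED, trivial) the crux gives the stub by forgetting the sign. -/
theorem stub_of_indexSzpiro (h : IndexSzpiro) : StubRealCubic := by
  intro ε hε
  obtain ⟨C, hC⟩ := h ε hε
  exact ⟨C, fun W _ K _ _ hirr h3 hθ _ => hC W K hirr h3 hθ⟩

/-! ## §T1 Strengthen-to-simplify, run to ground (negative on every axis, inside one field) -/

/-- **S⁰_A.** The real stub AT `ε = 0` with allowance exponent `A` on `|d_K|` (`A = 1` is the stub's own
allowance).  FALSE for every `A` (`not_realAllowanceEpsZero_of_tower` + `BYFixedFieldTower`). -/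
def RealAllowanceEpsZero (A : ℕ) : Prop :=
  ∃ C : ℝ, ∀ (W : WeierstrassCurve ℚ) [W.IsElliptic] (K : Type) [Field K] [NumberField K],
    Irreducible W.twoTorsionPolynomial.toPoly → Module.finrank ℚ K = 3 →
    (∃ θ : K, aeval θ W.twoTorsionPolynomial.toPoly = 0) → 0 < NumberField.discr K →
    (W.minimalDiscriminantNorm ℤ : ℝ) ≤ C * |(NumberField.discr K : ℝ)| ^ A * (W.conductorNorm ℤ : ℝ) ^ (6 : ℕ)

/-- **S^κ.** The real stub with exponent `κ` in place of `6 + ε`.  For `κ < 6` it is refuted IN PRINT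
(Bennett–Yazdani 2012 Prop. 7.4 at `F = 37a1`: infinitely many semistable `E` with `E[6] ≅ F[6]`, hence
`K_E = K₁₄₈`, and `|Δ_min| ≥ 37·N⁶`); `κ = 6` is `RealAllowanceEpsZero 1`. [cite: doi:10.1080/10586458.2012.645780, Prop. 7.4] -/
def RealExponent (κ : ℝ) : Prop :=
  ∃ C : ℝ, ∀ (W : WeierstrassCurve ℚ) [W.IsElliptic] (K : Type) [Field K] [NumberField K],
    Irreducible W.twoTorsionPolynomial.toPoly → Module.finrank ℚ K = 3 →
    (∃ θ : K, aeval θ W.twoTorsionPolynomial.toPoly = 0) → 0 < NumberField.discr K →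
    (W.minimalDiscriminantNorm ℤ : ℝ) ≤ C * |(NumberField.discr K : ℝ)| * (W.conductorNorm ℤ : ℝ) ^ κ

/-- **THE RESIDUAL FACT (L; not in print as stated).**  Unbounded Szpiro excess INSIDE ONE REAL CUBIC FIELD:
for every `B` an elliptic `W/ℚ` with irreducible 2-division cubic whose stem field has `d_K = 148`
(`= ℚ(37a1[2])`) and `B · N⁶ ≤ |Δ_min|`.  Derivation: `X_F(6) ≅ (y² = x³ + 37)` for `F = 37a1`
(Chen 1403.7557 Thm 3.9 / Rubin–Silverberg 1999); every `E` on it has `E[6] ≅ F[6]`, so `K_E = K₁₄₈`,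
`6 ∣ v_ℓ(Δ_E)` at multiplicative `ℓ ∤ 6·37` (Kummer/Tate), `v₃₇(Δ_E) ≡ 1 (mod 6)`; a `ℚ₃₇`-rational cusp exists
(Tate curves `q = q_F u⁶`, `u → 0`); and `X_F(6)(ℚ)` is 37-adically DENSE in `X_F(6)(ℚ₃₇)` because
(i) a rational point of exact formal level 1 exists (`T1b`), (ii) reduction hits a generator of
`Ẽ_ns(𝔽₃₇) ≅ ℤ/37` (`T1c`), (iii) Kodaira type II: every `ℚ₃₇`-point is nonsingular mod 37 (`T1e`), and
`[2]` is bijective on `X_F(6)(ℚ₃₇)` (`T1d`), so the Bennett–Yazdani image `2Γ` is dense too.  Rational points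
`37`-adically close to the cusp give `v₃₇(Δ_min) = 1 + 6k`, `k → ∞`, whence `|Δ_min|/N⁶ ≥ 37^{6k−5}/(2⁶3³⁰) → ∞`.
[cite: doi:10.1080/10586458.2012.645780, §7; arXiv:1403.7557, Thm 3.9] -/
def BYFixedFieldTower : Prop :=
  ∀ B : ℕ, ∃ (W : WeierstrassCurve ℚ) (_ : W.IsElliptic), Irreducible W.twoTorsionPolynomial.toPoly ∧
    (∀ (K : Type) [Field K] [NumberField K], Module.finrank ℚ K = 3 →
      (∃ θ : K, aeval θ W.twoTorsionPolynomial.toPoly = 0) → NumberField.discr K = 148) ∧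
    0 < W.conductorNorm ℤ ∧ B * W.conductorNorm ℤ ^ 6 ≤ W.minimalDiscriminantNorm ℤ

/-- (VERIFIED, = k2-gen-5/gen-7 `exists_resolventField`) a stem field of the irreducible 2-division cubic. -/
theorem exists_resolventField (W : WeierstrassCurve ℚ) (hirr : Irreducible W.twoTorsionPolynomial.toPoly) :
    ∃ (K : Type) (_ : Field K) (_ : NumberField K),
      Module.finrank ℚ K = 3 ∧ ∃ θ : K, aeval θ W.twoTorsionPolynomial.toPoly = 0 := by
  haveI : Fact (Irreducible W.twoTorsionPolynomial.toPoly) := ⟨hirr⟩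
  have hdeg : W.twoTorsionPolynomial.toPoly.natDegree = 3 :=
    Cubic.natDegree_of_a_ne_zero (by norm_num [WeierstrassCurve.twoTorsionPolynomial])
  have hfin : Module.finrank ℚ (AdjoinRoot W.twoTorsionPolynomial.toPoly) = 3 := by
    rw [(AdjoinRoot.powerBasis hirr.ne_zero).finrank, AdjoinRoot.powerBasis_dim, hdeg]
  have hroot := AdjoinRoot.aeval_eq (f := W.twoTorsionPolynomial.toPoly) W.twoTorsionPolynomial.toPoly
  rw [AdjoinRoot.mk_self] at hroot
  have keyfin : ∀ inst : Module ℚ (AdjoinRoot W.twoTorsionPolynomial.toPoly),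
      @Module.finrank ℚ (AdjoinRoot W.twoTorsionPolynomial.toPoly) _ _ inst = 3 := by
    intro inst
    obtain rfl := Subsingleton.elim inst
      (@Algebra.toModule _ _ _ _ (AdjoinRoot.instAlgebra W.twoTorsionPolynomial.toPoly))
    exact hfin
  have keyroot : ∀ inst : Algebra ℚ (AdjoinRoot W.twoTorsionPolynomial.toPoly),
      @aeval ℚ (AdjoinRoot W.twoTorsionPolynomial.toPoly) _ _ inst
        (AdjoinRoot.root W.twoTorsionPolynomial.toPoly) W.twoTorsionPolynomial.toPoly = 0 := by
    intro inst
    obtain rfl := Subsingleton.elim inst (AdjoinRoot.instAlgebra W.twoTorsionPolynomial.toPoly)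
    exact hroot
  exact ⟨AdjoinRoot W.twoTorsionPolynomial.toPoly, inferInstance, inferInstance, keyfin _,
    AdjoinRoot.root _, keyroot _⟩

/-- **GLUE (VERIFIED).**  The tower kills `ε = 0` on the real class for EVERY allowance exponent `A`
(the field is fixed, so no power of `|d_K| = 148` helps). -/
theorem not_realAllowanceEpsZero_of_tower (h : BYFixedFieldTower) (A : ℕ) : ¬ RealAllowanceEpsZero A := by
  rintro ⟨C, hC⟩
  obtain ⟨B, hB⟩ := exists_nat_gt (max C 0 * (148 : ℝ) ^ A)
  obtain ⟨W, hE, hirr, hK, hN, hineq⟩ := h B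
  haveI := hE
  obtain ⟨K, _, _, h3, hθ⟩ := exists_resolventField W hirr
  have hd : NumberField.discr K = 148 := hK K h3 hθ
  have hpos : 0 < NumberField.discr K := by rw [hd]; norm_num
  have h1 := hC W K hirr h3 hθ hpos
  have hdR : |(NumberField.discr K : ℝ)| = 148 := by
    rw [show (NumberField.discr K : ℝ) = ((148 : ℤ) : ℝ) by rw [hd]]; norm_num
  rw [hdR] at h1
  have hN6 : (0 : ℝ) < (W.conductorNorm ℤ : ℝ) ^ (6 : ℕ) := by positivity
  have h2 : (B : ℝ) * (W.conductorNorm ℤ : ℝ) ^ (6 : ℕ) ≤ (W.minimalDiscriminantNorm ℤ : ℝ) := by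
    exact_mod_cast hineq
  have h3' : C * (148 : ℝ) ^ A * (W.conductorNorm ℤ : ℝ) ^ (6 : ℕ)
      ≤ max C 0 * (148 : ℝ) ^ A * (W.conductorNorm ℤ : ℝ) ^ (6 : ℕ) := by
    gcongr; exact le_max_left _ _
  have h4 : (B : ℝ) * (W.conductorNorm ℤ : ℝ) ^ (6 : ℕ) ≤ max C 0 * (148 : ℝ) ^ A * (W.conductorNorm ℤ : ℝ) ^ (6 : ℕ) :=
    h2.trans (h1.trans h3')
  have h5 : (B : ℝ) ≤ max C 0 * (148 : ℝ) ^ A := le_of_mul_le_mul_right h4 hN6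
  linarith

/-- **GLUE (VERIFIED).**  Conversely `ε = 0` (allowance `A = 1`) would give the stub — recorded only to fix the
direction of the lattice `S⁰ ⇒ stub ⇐ IndexSzpiro`. -/
theorem stubRealCubic_of_realAllowanceEpsZero_one (h : RealAllowanceEpsZero 1) : StubRealCubic := by
  intro ε hε
  obtain ⟨C, hC⟩ := h
  refine ⟨max C 0, fun W _ K _ _ hirr h3 hθ hpos => ?_⟩
  have h1 := hC W K hirr h3 hθ hpos
  rw [pow_one] at h1
  have hd0 : (0 : ℝ) ≤ |(NumberField.discr K : ℝ)| := abs_nonneg _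
  rcases Nat.eq_zero_or_pos (W.conductorNorm ℤ) with hN | hN
  · have hN' : (W.conductorNorm ℤ : ℝ) = 0 := by exact_mod_cast hN
    rw [hN'] at h1 ⊢
    rw [Real.zero_rpow (by linarith)]
    simpa using h1
  · have hN1 : (1 : ℝ) ≤ (W.conductorNorm ℤ : ℝ) := by exact_mod_cast hN
    have hpow : (W.conductorNorm ℤ : ℝ) ^ (6 : ℕ) ≤ (W.conductorNorm ℤ : ℝ) ^ (6 + ε) := by
      rw [← Real.rpow_natCast]
      exact Real.rpow_le_rpow_of_exponent_le hN1 (by push_cast; linarith)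
    calc (W.minimalDiscriminantNorm ℤ : ℝ) ≤ C * |(NumberField.discr K : ℝ)| * (W.conductorNorm ℤ : ℝ) ^ (6 : ℕ) := h1
      _ ≤ max C 0 * |(NumberField.discr K : ℝ)| * (W.conductorNorm ℤ : ℝ) ^ (6 : ℕ) := by
          gcongr; exact le_max_left _ _
      _ ≤ max C 0 * |(NumberField.discr K : ℝ)| * (W.conductorNorm ℤ : ℝ) ^ (6 + ε) := by
          gcongr

/-! ### One-cycle inputs of the 37-adic density step (`F = 37a1`, `X_F(6) ≅ y² = x³ + 37`) -/

/-- **T1b (VERIFIED).**  A rational point of EXACT formal level 1 at `p = 37` on `y² = x³ + 37`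
(witness `P = 2·(−1,6) + 5·(3,8)`: `x = 79405796165528784931 / (37·51180555)²`, `37 ∤` numerator;
so the closure of `X_F(6)(ℚ) ∩ Ê(37ℤ₃₇)` is all of `Ê(37ℤ₃₇)`).  Proof: `norm_num` + `padicValRat.div`,
`padicValNat` of explicit numerals. [computed: folder/level37b.py] -/
theorem T1b_levelOnePoint [Fact (Nat.Prime 37)] : ∃ x y : ℚ, y ^ 2 = x ^ 3 + 37 ∧ padicValRat 37 x = -2 := by
  refine ⟨79405796165528784931 / 3586025968637886225,
    708789152564273871363490863796 / 6790787574814085607827130375, by norm_num, ?_⟩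
  have h : (79405796165528784931 / 3586025968637886225 : ℚ)
      = ((79405796165528784931 : ℕ) : ℚ) / ((37 ^ 2 * 2619449210108025 : ℕ) : ℚ) := by norm_num
  rw [h, padicValRat.div (by norm_num) (by norm_num), padicValRat.of_nat, padicValRat.of_nat,
    padicValNat.mul (by norm_num) (by norm_num), padicValNat.prime_pow,
    padicValNat.eq_zero_of_not_dvd (show ¬ 37 ∣ 79405796165528784931 by norm_num),
    padicValNat.eq_zero_of_not_dvd (show ¬ 37 ∣ 2619449210108025 by norm_num)]
  push_cast

/-- **T1c (VERIFIED).**  `(−1, 6)` reduces to a NONSINGULAR point of `y² = x³ (mod 37)` with nonzero parameter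
`x/y`, i.e. to a generator of `Ẽ_ns(𝔽₃₇) ≅ ℤ/37` (Bennett–Yazdani Lemma 7.3 in this instance). -/
theorem T1c_reduction_generator :
    ((6 : ZMod 37) ^ 2 = (-1 : ZMod 37) ^ 3 + 37) ∧ ((-1 : ZMod 37) ≠ 0) ∧ ((6 : ZMod 37) ≠ 0) := by
  refine ⟨?_, ?_, ?_⟩ <;> decide

/-- **T1d (VERIFIED).**  No `ℚ₃₇`-rational 2-torsion on `y² = x³ + 37` (`3·v(x) = v(−37) = 1` is impossible), so `[2]`
is a bijection of the compact group `X_F(6)(ℚ₃₇)` and the Bennett–Yazdani image `2Γ` is dense iff `Γ` is. -/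
theorem T1d_no_padic_twoTorsion [Fact (Nat.Prime 37)] : ∀ x : ℚ_[37], x ^ 3 + 37 ≠ 0 := by
  intro x hx
  have hx3 : x ^ 3 = -37 := eq_neg_of_add_eq_zero_left hx
  have hx0 : x ≠ 0 := by
    rintro rfl
    norm_num at hx3
  have h37 : ‖(37 : ℚ_[37])‖ = (37 : ℝ)⁻¹ := by
    have := Padic.norm_p (p := 37)
    simpa using this
  have hn : ‖x‖ ^ 3 = (37 : ℝ)⁻¹ := by
    rw [← norm_pow, hx3, norm_neg, h37]
  rw [Padic.norm_eq_zpow_neg_valuation hx0, ← zpow_natCast, ← zpow_mul, ← zpow_neg_one] at hn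
  have hinj := zpow_right_injective₀ (by norm_num : (0:ℝ) < 37) (by norm_num : (37:ℝ) ≠ 1) hn
  push_cast at hinj
  omega

/-- **T1e (VERIFIED).**  Kodaira type II at 37: no `ℚ₃₇`-point of `y² = x³ + 37` reduces to the cusp `(0,0)`
(`v(x), v(y) ≥ 1 ⇒ v(y² − x³) ≥ 2 ≠ v(37) = 1`); hence `E(ℚ₃₇) = E₀(ℚ₃₇)` and, with T1b–T1c,
`X_F(6)(ℚ)` is dense in `X_F(6)(ℚ₃₇)` — in particular it accumulates at the `ℚ₃₇`-rational cusp. -/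
theorem T1e_no_point_on_cusp [Fact (Nat.Prime 37)] :
    ∀ x y : ℚ_[37], y ^ 2 = x ^ 3 + 37 → ¬ (‖x‖ < 1 ∧ ‖y‖ < 1) := by
  rintro x y h ⟨hx, hy⟩
  -- discreteness of the 37-adic absolute value: `‖z‖ < 1 → ‖z‖ ≤ 37⁻¹`
  have key : ∀ z : ℚ_[37], ‖z‖ < 1 → ‖z‖ ≤ (37 : ℝ)⁻¹ := by
    intro z hz
    by_cases hz0 : z = 0
    · subst hz0; simp
    · rw [Padic.norm_eq_zpow_neg_valuation hz0] at hz ⊢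
      have hv : 0 < z.valuation := by
        by_contra hcon
        have : (1 : ℝ) ≤ ((37 : ℕ) : ℝ) ^ (-z.valuation) := one_le_zpow₀ (by norm_num) (by omega)
        linarith
      calc ((37 : ℕ) : ℝ) ^ (-z.valuation) ≤ ((37 : ℕ) : ℝ) ^ (-1 : ℤ) := by
            rw [zpow_le_zpow_iff_right₀ (by norm_num)]; omega
        _ = (37 : ℝ)⁻¹ := by simp
  have hx' := key x hx
  have hy' := key y hy
  have h37 : ‖(37 : ℚ_[37])‖ = (37 : ℝ)⁻¹ := by
    have := Padic.norm_p (p := 37)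
    simpa using this
  have hxx : ‖x ^ 3‖ ≤ (37 : ℝ)⁻¹ ^ 3 := by rw [norm_pow]; gcongr
  have hyy : ‖y ^ 2‖ ≤ (37 : ℝ)⁻¹ ^ 2 := by rw [norm_pow]; gcongr
  have h37' : (37 : ℚ_[37]) = y ^ 2 + (-(x ^ 3)) := by rw [h]; ring
  have hle : ‖y ^ 2 + (-(x ^ 3))‖ ≤ max ‖y ^ 2‖ ‖-(x ^ 3)‖ := Padic.nonarchimedean _ _
  rw [← h37', norm_neg, h37] at hle
  have hmax : max ‖y ^ 2‖ ‖x ^ 3‖ ≤ (37 : ℝ)⁻¹ ^ 2 := max_le hyy (hxx.trans (by norm_num))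
  have := hle.trans hmax
  norm_num at this

/-! ## §T2 Why the tree's Bennett–Yazdani family cannot serve the real `r = 0` class (it is `r = 1`) -/

/-- **T2a (VERIFIED).**  The curve `h_λ(s) = 2s³ + 3λs² − (λ³ − 1) = 0` (the 2-division cubic of the tree model
`y² + m xy + b y = x³`, `27b = m³ − n³`, `λ = m/n`, rescaled: `ψ₂(−n²s²/9)·729/n⁶ = h_λ(s)·h_λ(−s)`) is a NODAL
cubic, parametrised by the pencil through its node at infinity: `λ = (2t³+1)/(3t²)`, `s = (t³−1)/(3t²)`. -/
theorem T2a_nodal_line (t : ℚ) (ht : t ≠ 0) :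
    2 * ((t ^ 3 - 1) / (3 * t ^ 2)) ^ 3 + 3 * ((2 * t ^ 3 + 1) / (3 * t ^ 2)) * ((t ^ 3 - 1) / (3 * t ^ 2)) ^ 2
      - (((2 * t ^ 3 + 1) / (3 * t ^ 2)) ^ 3 - 1) = 0 := by
  field_simp
  ring

/-- **T2b (VERIFIED).**  The 2-division cubic of `y² + m xy + b y = x³` is `4x³ + m²x² + 2mb·x + b²`. -/
theorem T2b_twoTorsionPolynomial_mk (m b : ℚ) :
    (WeierstrassCurve.mk m 0 b 0 0).twoTorsionPolynomial = ⟨4, m ^ 2, 2 * m * b, b ^ 2⟩ := by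
  simp only [WeierstrassCurve.twoTorsionPolynomial, WeierstrassCurve.b₂, WeierstrassCurve.b₄,
    WeierstrassCurve.b₆, Cubic.mk.injEq]
  refine ⟨trivial, ?_, ?_, ?_⟩ <;> ring

/-- **T2c (VERIFIED; `T2b` + `field_simp; ring`).**  Along the nodal pencil the 2-division cubic HAS A RATIONAL ROOT
`x₀ = −n²(t³−1)²/(81t⁴)`: with `m = n(2t³+1)/(3t²)`, `27 b = m³ − n³`, `ψ₂(x₀) = 0`.  The map `t ↦ X = 6λ` is a
degree-3 cover of the `X`-line branched exactly over the 2-torsion of `D : Y² = X³ − 216` with type `(2,1)`, so it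
pulls back to an UNRAMIFIED cubic cover `D̃ → D`, i.e. a 3-isogeny `φ`; `{P ∈ D(ℚ) : ψ₂(E_P) reducible} ⊇ φ(D̃(ℚ))
⊇ ⟨(10,28),(6,0)⟩ + 3D(ℚ)` (checked exactly on all `nR + εT`, `n ≤ 4`: folder/orbit_t.py). -/
theorem T2c_root_along_isogeny (t n : ℚ) (ht : t ≠ 0) :
    (WeierstrassCurve.mk (n * (2 * t ^ 3 + 1) / (3 * t ^ 2)) 0
        (((n * (2 * t ^ 3 + 1) / (3 * t ^ 2)) ^ 3 - n ^ 3) / 27) 0 0).twoTorsionPolynomial.toPoly.eval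
      (-(n ^ 2 * (t ^ 3 - 1) ^ 2) / (81 * t ^ 4)) = 0 := by
  rw [T2b_twoTorsionPolynomial_mk]
  simp only [Cubic.toPoly, eval_add, eval_mul, eval_C, eval_pow, eval_X]
  field_simp
  ring

/-- **T2d (VERIFIED; Mathlib `Polynomial.degree_eq_one_of_irreducible_of_root` + `Cubic.degree_of_a_ne_zero`).**
A 2-division cubic with a rational root is not irreducible. -/
theorem T2d_not_irreducible_of_root (W : WeierstrassCurve ℚ) (x₀ : ℚ)
    (hx : W.twoTorsionPolynomial.toPoly.eval x₀ = 0) : ¬ Irreducible W.twoTorsionPolynomial.toPoly := by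
  intro hirr
  have h1 : W.twoTorsionPolynomial.toPoly.degree = 1 :=
    Polynomial.degree_eq_one_of_irreducible_of_root hirr (Polynomial.IsRoot.def.mpr hx)
  have h3 : W.twoTorsionPolynomial.toPoly.degree = 3 :=
    Cubic.degree_of_a_ne_zero (by norm_num [WeierstrassCurve.twoTorsionPolynomial])
  have h13 : (3 : WithBot ℕ) = 1 := h3.symm.trans h1
  exact absurd h13 (by decide)

/-- **TreeOrbitIsR1 (typed; conjecture-grade, ⟸ `D(ℚ) = ⟨(10,28),(6,0)⟩`, i.e. rank `D = 1` — LMFDB check is the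
cheapest falsifier).**  EVERY curve of the tree's real Bennett–Yazdani component (`λ³ − 1 = 6□`, equivalently a
rational point of `Y² = X³ − 216` with `X ≠ 6`) has a rational 2-torsion point.  Consequence: the tree theorem
`Literature.Barriers.ABC.exists_semistable_minOrd_ge_six_excess_ge` is an `ε = 0` witness for the QUADRATIC
resolvent class with `K = ℚ(√2)` FIXED (`Δ = (bn)³`, `bn = 2(w/3)²`) — it bears on `QuadraticIndexSzpiro`
(stmt-ABC-22741), not on this stub. -/
def TreeOrbitIsR1 : Prop :=
  ∀ m n : ℚ, n ≠ 0 → m ≠ n → (∃ w : ℚ, n * (m ^ 3 - n ^ 3) = 6 * w ^ 2) →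
    ¬ Irreducible (WeierstrassCurve.mk m 0 ((m ^ 3 - n ^ 3) / 27) 0 0).twoTorsionPolynomial.toPoly

end Summit.ABC.ABC.Cruxes.IndexSzpiro.StubIdeas2RealG15

end
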